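import Summits.QuantumFields.BalabanUV.Beta.GAN24.CombesThomas

/-!
# `BalabanUV.Beta.GAN24.StencilSlotLam` — binder row G-an2-4 / (CONV-C), AFTER the K-slot: the LAGRANGE PIECE (P-Λ) of the wall's
# STENCIL slot `(hS, hSall)` IS A FUNCTION OF THE K-SLOT — in the K-slot's units it is `(cΛ·Lc^{2(d+1)}) • S^Λ` built from the
# UNIT-NORMALISED step resolvents, hence `j`-uniformly local from `UnitDecayK` alone (note `HOME/b2b-balaban-gan24-p1/S-SLOT.md`
# §2 (P-Λ), §4 (U-S2), §5 target S2)

NOT IN PRINT; OUR PROOF ATTEMPT (row owner b2b-balaban-gan24-p1, gen 3).  HONEST FRAMING (cell contract, verbatim): «discharging `BetaPertH`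
makes Bałaban's UV stability UNCONDITIONAL — a real constructive-QFT result; it is NOT the continuum limit and NOT the Clay problem.»
HONEST DEPENDENCY (verbatim): «continuum YM on T⁴ ⇐ BetaPertH ∧ nine spine estimates (0/9 proved); BetaPertH ⇐ (D1) ∧ (D4) ∧ CAP+tail;
G-an2-4 gates asym, D1 and NE2/3/4.»  [folklore] bookkeeping over the tree's own definitions (an2's `unitS`/`unitK`, `E2`, `lamCoeffK`,
`InterLevelTransport.SLam`, an1's `hessFF`) plus the composition brick `BalabanStepJetsSucc.abs_lamCoeffK_le` BY NAME; no new estimate,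
no cited fact, no `def`, no `Prop` mirror.  The K-slot data enter as the HYPOTHESIS `UnitDecayK d Lc (sfStep Lc) (smStep d Lc) C δ`
(`GAN24.CombesThomas`, = the wall's `hK` in the adopted units; for `d = 3` it is CONCLUDED by road P1: `GAN24/FibreStrip.unitDecayK_holds`,
p203939) — asserted nowhere here.  NOTHING of the wall is discharged: `(hS, hSall)` concern the WHOLE family `(JsBal0Of … j).S`, of which the
expression below is ONE of three summands of the members `j + 1` (`BalabanStepJetsSucc.Sstep … (j+1)`); the value-function third jet `e3Of`
(S-SLOT.md (P-E‴), LOCATED: fine-level minimiser columns, not covered by road P1) and member `0` (`BalabanStepJets.S0`) are untouched;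
the (V-H) summand is `GAN24/StencilSlotVH` (p203951).  0 wall binders instantiated.  NOT summit progress.

## What is proved (generic `d`; `Lc` with `NeZero Lc`; `n = j + 1 ≥ 1`; units `sfStep Lc n = Lc^n`, `smStep d Lc n = Lc^{n(d+1)}` BY NAME)
The (P-Λ) summand of `Sstep d Lc cE cVH cΛ (j+1)` is
`fun κ u ↦ (cΛ * wΛ d Lc (j+1)) • SLam Lc (lamCoeffK (KInvStep Lc (j+1)) (E2 d Lc (j+1)) Lc) (fun μ y ↦ hessFF Lc μ y) κ u`, weight
`wΛ d Lc n = (Lc^n)^{4(d+2)}` (an2/an4 v1.2, «PROVISIONAL … certified only by (R1)»).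
* §1 algebra: `hessFF` and `S^Λ` built on it vanish off the field–field block (`SLam_hessFF_off`); `unitS` is the SCALAR
  `(s_f s_m)⁻¹ s_f⁻²` on field–field-supported families (`unitS_smul_ffOnly`); `S^Λ` is linear in its coefficients (`SLam_smul`);
  **`lamCoeffK_unit`**: `lamCoeffK A E = ((s_m s_f)⁻¹ t⁻¹) · lamCoeffK (unitK s_f s_m A) (t • E)` for `E` with vanishing multiplier rows.
* §2 THE `E″`-DICTIONARY: **`E2_succ_inl_inl`** — `E2 d Lc (j+1) z u (inl α) (inl κ) = KInvStep Lc j (Lc•z) (Lc•u) (inr α) (inr κ)` (the value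
  Hessian of the `(j+1)`-composite IS the multiplier block of the step-`j` resolvent, re-indexed by `Lc`); hence **`decays_E2unit`**:
  `Decays (KStepUnit Lc j) C δ → Decays ((smStep d Lc j)^2 • E2 d Lc (j+1)) C δ` (`0 ≤ δ`, the dilation only helps).
* §3 **(U-S2) `lam_unit_factor`**: `(s_f′s_m′)⁻¹·s_f′⁻²·(cΛ·wΛ (j+1))·((s_m′s_f′)⁻¹·(s_m_j²)⁻¹) = cΛ·Lc^{2(d+1)}` at the adopted units — the KERNEL
  CHECK of an2's numeral `wΛ = (Lc^n)^{4(d+2)}` against the K-slot's units: every power of `Lc^j` cancels, a `j`-FREE `Lc^{2(d+1)}` remains.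
* §4 **`unitS_lamPiece_eq`**: `unitS (sfStep Lc (j+1)) (smStep d Lc (j+1)) (Λ-summand at j+1) = fun κ u ↦ (cΛ * Lc^{2(d+1)}) •
  SLam Lc (lamCoeffK (KStepUnit Lc (j+1)) ((smStep d Lc j)^2 • E2 d Lc (j+1)) Lc) (fun μ y ↦ hessFF Lc μ y) κ u` — the normalised Λ-summand
  is `S^Λ` of the UNIT-NORMALISED resolvents; and **`locStencil_unitS_lamPiece`**: from `UnitDecayK d Lc (sfStep Lc) (smStep d Lc) C δ`
  (`0 < δ`, `1 ≤ Lc`) the `hS`-shape for this summand at EVERY member `j + 1` with ONE `j`-FREE constant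
  `|cΛ·Lc^{2(d+1)}| · (d+1)·(|Fib d|·C²·Zl(δ/2) · 2ℓ²e^{2(d+1)Lcδ} · Zl(δ/4))`, rate `δ/4` (`ℓ = ell (d+1) Lc`).
So, GIVEN the K-slot, the Lagrange summand of the S-slot costs bookkeeping only; its one-step drift (from `CauchyDecayK`, same dictionary +
`HessKerRate` telescoping) is the next append.  What the K-slot does NOT give is (P-E‴) — S-SLOT.md §2–§3.
-/

noncomputable section

open Literature.MathematicalPhysics.QuantumFieldTheory
open Literature.MathematicalPhysics.QuantumFieldTheory.Balaban1983to89
open Literature.MathematicalPhysics.QuantumFieldTheory.Balaban1983to89.Beta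
open B12Sec2to5 (l1 l1_nonneg)
open ExpKernelCalculus (MKer Decays BiLoc VertexFamily comp Zl Zl_nonneg)
open OneStepResolventKernel (Fib LocStencil)
open OneStepKernelFamily (KInvStep dec legSet legW legPt)
open InterLevelTransport (SLam cwsum cwsum_apply locStencil_SLam)
open AveragingHessianKernels (hessFF ell biLoc_hessFF hessFF_inl_inl)
open BalabanStepJetsSucc (wΛ E2 mmRead mmRead_eq_dec lamCoeffK abs_lamCoeffK_le l1_sub_le_l1_smul_sub)
open Summit.QuantumFields.BalabanUV.Beta.HessKerDressedUnits (unitK unitS legScale unitS_apply unitK_apply legScale_inl legScale_inr)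
open Summit.QuantumFields.BalabanUV.Beta.GAN24.CombesThomas (sfStep smStep sfStep_ne_zero smStep_ne_zero KStepUnit UnitDecayK)

namespace Summit.QuantumFields.BalabanUV.Beta.GAN24.StencilSlotLam

variable {d : ℕ}

/-! ## §1 Algebra: block support of `hessFF` / `S^Λ`, `unitS` on field–field families, linearity of `S^Λ`, units through `lamCoeffK` -/

/-- [folklore] `hessFF` vanishes on the `(inl, inr)` block. -/
theorem hessFF_inl_inr (L : ℕ) (μ : Fin (d + 1)) (y x x' : Fin (d + 1) → ℤ) (α ν : Fin (d + 1)) :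
    hessFF L μ y x x' (Sum.inl α) (Sum.inr ν) = 0 := rfl

/-- [folklore] `hessFF` vanishes on the `(inr, inl)` block. -/
theorem hessFF_inr_inl (L : ℕ) (μ : Fin (d + 1)) (y x x' : Fin (d + 1) → ℤ) (ν α : Fin (d + 1)) :
    hessFF L μ y x x' (Sum.inr ν) (Sum.inl α) = 0 := rfl

/-- [folklore] `hessFF` vanishes on the `(inr, inr)` block. -/
theorem hessFF_inr_inr (L : ℕ) (μ : Fin (d + 1)) (y x x' : Fin (d + 1) → ℤ) (ν ν' : Fin (d + 1)) :
    hessFF L μ y x x' (Sum.inr ν) (Sum.inr ν') = 0 := rfl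

section SLamAlgebra

variable {N : ℕ} [NeZero N]

/-- [folklore] `S^Λ` over a kernel family is `0` at an entry where every member of the family is `0`. -/
theorem SLam_entry_zero (c : Fin (d + 1) → (Fin (d + 1) → ℤ) → Fin (d + 1) → (Fin (d + 1) → ℤ) → ℝ)
    {Q : Fin (d + 1) → (Fin (d + 1) → ℤ) → MKer (d + 1) (Fib d)} {x z : Fin (d + 1) → ℤ} {a b : Fib d}
    (hQ : ∀ μ y, Q μ y x z a b = 0) (κ : Fin (d + 1)) (u : Fin (d + 1) → ℤ) : SLam N c Q κ u x z a b = 0 := by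
  simp only [SLam, cwsum_apply, hQ, mul_zero, tsum_zero, Finset.sum_const_zero, neg_zero]

/-- [folklore] `S^Λ` built on an1's `hessFF` vanishes on the `(inl, inr)` block. -/
theorem SLam_hessFF_inl_inr (c : Fin (d + 1) → (Fin (d + 1) → ℤ) → Fin (d + 1) → (Fin (d + 1) → ℤ) → ℝ) (L : ℕ)
    (κ : Fin (d + 1)) (u x z : Fin (d + 1) → ℤ) (α ν : Fin (d + 1)) :
    SLam N c (fun μ y => hessFF (d := d) L μ y) κ u x z (Sum.inl α) (Sum.inr ν) = 0 :=
  SLam_entry_zero c (fun μ y => hessFF_inl_inr L μ y x z α ν) κ u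

/-- [folklore] `S^Λ` built on `hessFF` vanishes on the `(inr, inl)` block. -/
theorem SLam_hessFF_inr_inl (c : Fin (d + 1) → (Fin (d + 1) → ℤ) → Fin (d + 1) → (Fin (d + 1) → ℤ) → ℝ) (L : ℕ)
    (κ : Fin (d + 1)) (u x z : Fin (d + 1) → ℤ) (ν α : Fin (d + 1)) :
    SLam N c (fun μ y => hessFF (d := d) L μ y) κ u x z (Sum.inr ν) (Sum.inl α) = 0 :=
  SLam_entry_zero c (fun μ y => hessFF_inr_inl L μ y x z ν α) κ u

/-- [folklore] `S^Λ` built on `hessFF` vanishes on the `(inr, inr)` block. -/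
theorem SLam_hessFF_inr_inr (c : Fin (d + 1) → (Fin (d + 1) → ℤ) → Fin (d + 1) → (Fin (d + 1) → ℤ) → ℝ) (L : ℕ)
    (κ : Fin (d + 1)) (u x z : Fin (d + 1) → ℤ) (ν ν' : Fin (d + 1)) :
    SLam N c (fun μ y => hessFF (d := d) L μ y) κ u x z (Sum.inr ν) (Sum.inr ν') = 0 :=
  SLam_entry_zero c (fun μ y => hessFF_inr_inr L μ y x z ν ν') κ u

/-- [folklore] **`S^Λ` IS LINEAR IN ITS COEFFICIENTS** (a scalar pulls out). -/
theorem SLam_smul (t : ℝ) (c : Fin (d + 1) → (Fin (d + 1) → ℤ) → Fin (d + 1) → (Fin (d + 1) → ℤ) → ℝ)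
    (Q : Fin (d + 1) → (Fin (d + 1) → ℤ) → MKer (d + 1) (Fib d)) :
    SLam N (fun μ y κ u => t * c μ y κ u) Q = fun κ u => t • SLam N c Q κ u := by
  funext κ u x z a b
  simp only [SLam, cwsum_apply, Pi.smul_apply, smul_eq_mul, Finset.mul_sum, mul_neg, ← tsum_mul_left, mul_assoc]

end SLamAlgebra

/-- [folklore] On a stencil family supported on the field–field block, `unitS s_f s_m (w • S)` is the SCALAR multiple
`((s_f s_m)⁻¹ (s_f⁻¹ s_f⁻¹) w) • S`. -/
theorem unitS_smul_ffOnly (sf sm w : ℝ) (S : Fin (d + 1) → (Fin (d + 1) → ℤ) → MKer (d + 1) (Fib d))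
    (hfm : ∀ κ u x y (α ν : Fin (d + 1)), S κ u x y (Sum.inl α) (Sum.inr ν) = 0)
    (hmf : ∀ κ u x y (ν α : Fin (d + 1)), S κ u x y (Sum.inr ν) (Sum.inl α) = 0)
    (hmm : ∀ κ u x y (ν ν' : Fin (d + 1)), S κ u x y (Sum.inr ν) (Sum.inr ν') = 0) :
    unitS sf sm (fun κ u => w • S κ u) = fun κ u => ((sf * sm)⁻¹ * (sf⁻¹ * sf⁻¹) * w) • S κ u := by
  funext κ u x y a b
  simp only [unitS_apply, Pi.smul_apply, smul_eq_mul]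
  rcases a with α | ν <;> rcases b with β | ν'
  · rw [legScale_inl, legScale_inl]; ring
  · rw [hfm]; ring
  · rw [hmf]; ring
  · rw [hmm]; ring

/-- [folklore] **UNITS THROUGH THE MULTIPLIER RESPONSE**: for a kernel `E` with vanishing multiplier rows (as `E2 j`), nonzero units
`s_f, s_m` and a nonzero weight `t`, `lamCoeffK A E N μ y κ u = ((s_m s_f)⁻¹ t⁻¹) · lamCoeffK (unitK s_f s_m A) (t • E) N μ y κ u` — the
`(inr, inl)` entry of `A ∘ E` in terms of the rescaled factors. -/
theorem lamCoeffK_unit {sf sm t : ℝ} (hsf : sf ≠ 0) (hsm : sm ≠ 0) (ht : t ≠ 0) (A E : MKer (d + 1) (Fib d))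
    (hE : ∀ y z (ν : Fin (d + 1)) (b : Fib d), E y z (Sum.inr ν) b = 0) (N : ℕ) (μ : Fin (d + 1)) (y : Fin (d + 1) → ℤ)
    (κ : Fin (d + 1)) (u : Fin (d + 1) → ℤ) :
    lamCoeffK A E N μ y κ u = ((sm * sf)⁻¹ * t⁻¹) * lamCoeffK (unitK sf sm A) (t • E) N μ y κ u := by
  unfold lamCoeffK ExpKernelCalculus.comp
  rw [← tsum_mul_left]
  refine tsum_congr fun w => ?_
  rw [Finset.mul_sum]
  refine Finset.sum_congr rfl fun f _ => ?_
  rcases f with α | ν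
  · simp only [unitK_apply, legScale_inr, legScale_inl, Pi.smul_apply, smul_eq_mul]
    field_simp
  · simp only [hE, Pi.smul_apply, smul_eq_mul, mul_zero]

/-! ## §2 The `E″`-dictionary: the value Hessian of the `(j+1)`-composite IS the multiplier block of the step-`j` resolvent -/

section Dictionary

variable {Lc : ℕ} [NeZero Lc]

/-- [folklore] `E2` vanishes on the `(inl, inr)` block. -/
theorem E2_inl_inr (j : ℕ) (z u : Fin (d + 1) → ℤ) (α ν : Fin (d + 1)) : E2 d Lc j z u (Sum.inl α) (Sum.inr ν) = 0 := rfl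

/-- [folklore] `E2` vanishes on the multiplier rows. -/
theorem E2_inr (j : ℕ) (z u : Fin (d + 1) → ℤ) (ν : Fin (d + 1)) (b : Fib d) : E2 d Lc j z u (Sum.inr ν) b = 0 := by
  rcases b with α | ν' <;> rfl

omit [NeZero Lc] in
/-- [folklore] Iterated dilation: `Lc^j • (Lc • z) = Lc^{j+1} • z` (casts from `ℕ`). -/
theorem pow_smul_smul (j : ℕ) (z : Fin (d + 1) → ℤ) :
    ((Lc ^ j : ℕ) : ℤ) • ((Lc : ℤ) • z) = ((Lc ^ (j + 1) : ℕ) : ℤ) • z := by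
  rw [smul_smul]
  congr 1

/-- [folklore] **THE `E″`-DICTIONARY**: `E2 d Lc (j+1) z u (inl α) (inl κ) = KInvStep Lc j (Lc•z) (Lc•u) (inr α) (inr κ)` — both are the entry
`KInv (Lc^{j+1}) (Lc^{j+1}•z) (Lc^{j+1}•u) (inr α) (inr κ)` of the packed resolvent of the `(j+1)`-fold composite (`mmRead_eq_dec` + the
definition of an4's `dec` on multiplier legs). -/
theorem E2_succ_inl_inl (j : ℕ) (z u : Fin (d + 1) → ℤ) (α κ : Fin (d + 1)) :
    E2 d Lc (j + 1) z u (Sum.inl α) (Sum.inl κ) =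
      KInvStep (d := d) Lc j ((Lc : ℤ) • z) ((Lc : ℤ) • u) (Sum.inr α) (Sum.inr κ) := by
  rw [E2, mmRead_eq_dec]
  simp only [KInvStep, dec, legSet, legW, legPt, Finset.sum_singleton, one_mul, pow_smul_smul]

/-- [folklore] The rescaled `E″`: `(s_m j)^2 • E2 d Lc (j+1)` has `(inl, inl)` entries `= KStepUnit Lc j (Lc•z) (Lc•u) (inr α) (inr κ)`
(the UNIT-NORMALISED step-`j` resolvent's multiplier block, re-indexed). -/
theorem smul_E2_succ_inl_inl (j : ℕ) (z u : Fin (d + 1) → ℤ) (α κ : Fin (d + 1)) :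
    ((smStep d Lc j) ^ 2 • E2 d Lc (j + 1)) z u (Sum.inl α) (Sum.inl κ) =
      KStepUnit (d := d) Lc j ((Lc : ℤ) • z) ((Lc : ℤ) • u) (Sum.inr α) (Sum.inr κ) := by
  simp only [Pi.smul_apply, smul_eq_mul, E2_succ_inl_inl, KStepUnit, unitK_apply, legScale_inr]
  ring

/-- [folklore] **DECAY OF THE RESCALED `E″` FROM THE K-SLOT AT LEVEL `j`**: `Decays (KStepUnit Lc j) C δ → Decays ((s_m j)^2 • E2 d Lc (j+1)) C δ`
for `0 ≤ δ` (the dilation by `Lc ≥ 1` only lengthens distances). -/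
theorem decays_E2unit {C δ : ℝ} {j : ℕ} (hK : Decays (KStepUnit (d := d) Lc j) C δ) (hδ : 0 ≤ δ) :
    Decays ((smStep d Lc j) ^ 2 • E2 d Lc (j + 1)) C δ := by
  have hC : 0 ≤ C := hK.nonneg (Sum.inl 0)
  have hLc : 1 ≤ Lc := Nat.one_le_iff_ne_zero.2 (NeZero.ne Lc)
  intro z u a b
  have hpos : 0 ≤ C * Real.exp (-δ * l1 (z - u)) := by positivity
  rcases a with α | ν
  · rcases b with κ | ν'
    · rw [smul_E2_succ_inl_inl]
      refine (hK _ _ _ _).trans (mul_le_mul_of_nonneg_left ?_ hC)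
      rw [Real.exp_le_exp]
      have h := l1_sub_le_l1_smul_sub (d := d) hLc z u
      nlinarith
    · simp only [Pi.smul_apply, smul_eq_mul, E2_inl_inr, mul_zero, abs_zero]
      exact hpos
  · simp only [Pi.smul_apply, smul_eq_mul, E2_inr, mul_zero, abs_zero]
    exact hpos

end Dictionary

/-! ## §3 (U-S2): the weight `wΛ (j+1) = (Lc^{j+1})^{4(d+2)}` against the units — all powers of `Lc^j` cancel -/

section Units

variable {Lc : ℕ} [NeZero Lc]

/-- [folklore] **(U-S2)**: `(s_f′ s_m′)⁻¹ · (s_f′⁻¹ s_f′⁻¹) · (cΛ · wΛ (j+1)) · ((s_m′ s_f′)⁻¹ · (s_m_j²)⁻¹) = cΛ · Lc^{2(d+1)}` with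
`s_f′ = Lc^{j+1}`, `s_m′ = Lc^{(j+1)(d+1)}`, `s_m_j = Lc^{j(d+1)}`: exponent count
`(j+1)·4(d+2) − [4(j+1) + 2(j+1)(d+1) + 2j(d+1)] = 2(d+1)`. -/
theorem lam_unit_factor (cΛ : ℝ) (j : ℕ) :
    (sfStep Lc (j + 1) * smStep d Lc (j + 1))⁻¹ * ((sfStep Lc (j + 1))⁻¹ * (sfStep Lc (j + 1))⁻¹) * (cΛ * wΛ d Lc (j + 1)) *
        ((smStep d Lc (j + 1) * sfStep Lc (j + 1))⁻¹ * ((smStep d Lc j) ^ 2)⁻¹) = cΛ * (Lc : ℝ) ^ (2 * (d + 1)) := by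
  have hL : (Lc : ℝ) ≠ 0 := Nat.cast_ne_zero.2 (NeZero.ne Lc)
  have h1 : wΛ d Lc (j + 1) = (sfStep Lc (j + 1) * smStep d Lc (j + 1)) * (sfStep Lc (j + 1) * sfStep Lc (j + 1)) *
      (smStep d Lc (j + 1) * sfStep Lc (j + 1)) * (smStep d Lc j) ^ 2 * (Lc : ℝ) ^ (2 * (d + 1)) := by
    simp only [sfStep, smStep, wΛ, ← pow_add, ← pow_mul]
    ring_nf
  have hsf : sfStep Lc (j + 1) ≠ 0 := sfStep_ne_zero (j + 1)
  have hsm : smStep d Lc (j + 1) ≠ 0 := smStep_ne_zero (d := d) (j + 1)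
  have hsmj : smStep d Lc j ≠ 0 := smStep_ne_zero (d := d) j
  rw [h1]
  field_simp

end Units

/-! ## §4 The normalised Lagrange summand = `S^Λ` of the unit-normalised resolvents; `j`-uniform locality from `UnitDecayK` -/

section Main

variable {Lc : ℕ} [NeZero Lc]

/-- [folklore] **THE NORMALISED (P-Λ) SUMMAND** of member `j + 1`: in the K-slot's units it is `(cΛ·Lc^{2(d+1)}) • S^Λ` with coefficients
`lamCoeffK (KStepUnit Lc (j+1)) ((s_m j)^2 • E2 d Lc (j+1)) Lc` — built from the UNIT-NORMALISED step resolvents of levels `j + 1` and `j`. -/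
theorem unitS_lamPiece_eq (cΛ : ℝ) (j : ℕ) :
    unitS (sfStep Lc (j + 1)) (smStep d Lc (j + 1))
        (fun κ u => (cΛ * wΛ d Lc (j + 1)) •
          SLam Lc (lamCoeffK (KInvStep (d := d) Lc (j + 1)) (E2 d Lc (j + 1)) Lc) (fun μ y => hessFF Lc μ y) κ u)
      = fun κ u => (cΛ * (Lc : ℝ) ^ (2 * (d + 1))) •
          SLam Lc (lamCoeffK (KStepUnit (d := d) Lc (j + 1)) ((smStep d Lc j) ^ 2 • E2 d Lc (j + 1)) Lc)
            (fun μ y => hessFF Lc μ y) κ u := by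
  have hsf : sfStep Lc (j + 1) ≠ 0 := sfStep_ne_zero (j + 1)
  have hsm : smStep d Lc (j + 1) ≠ 0 := smStep_ne_zero (d := d) (j + 1)
  have ht : (smStep d Lc j) ^ 2 ≠ 0 := pow_ne_zero 2 (smStep_ne_zero (d := d) j)
  -- the coefficients through the rescaled factors
  have hc : lamCoeffK (KInvStep (d := d) Lc (j + 1)) (E2 d Lc (j + 1)) Lc = fun μ y κ u =>
      ((smStep d Lc (j + 1) * sfStep Lc (j + 1))⁻¹ * ((smStep d Lc j) ^ 2)⁻¹) *
        lamCoeffK (KStepUnit (d := d) Lc (j + 1)) ((smStep d Lc j) ^ 2 • E2 d Lc (j + 1)) Lc μ y κ u := by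
    funext μ y κ u
    exact lamCoeffK_unit hsf hsm ht _ _ (fun y z ν b => E2_inr (j + 1) y z ν b) Lc μ y κ u
  rw [hc, SLam_smul]
  have hfun : (fun κ u => (cΛ * wΛ d Lc (j + 1)) •
      (fun κ u => ((smStep d Lc (j + 1) * sfStep Lc (j + 1))⁻¹ * ((smStep d Lc j) ^ 2)⁻¹) •
        SLam Lc (lamCoeffK (KStepUnit (d := d) Lc (j + 1)) ((smStep d Lc j) ^ 2 • E2 d Lc (j + 1)) Lc)
          (fun μ y => hessFF Lc μ y) κ u) κ u)
      = fun κ u => ((cΛ * wΛ d Lc (j + 1)) * (((smStep d Lc (j + 1) * sfStep Lc (j + 1))⁻¹ * ((smStep d Lc j) ^ 2)⁻¹))) •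
        SLam Lc (lamCoeffK (KStepUnit (d := d) Lc (j + 1)) ((smStep d Lc j) ^ 2 • E2 d Lc (j + 1)) Lc)
          (fun μ y => hessFF Lc μ y) κ u := by
    funext κ u
    rw [smul_smul]
  rw [hfun, unitS_smul_ffOnly _ _ _ _ (fun κ u x y α ν => SLam_hessFF_inl_inr _ Lc κ u x y α ν)
    (fun κ u x y ν α => SLam_hessFF_inr_inl _ Lc κ u x y ν α) (fun κ u x y ν ν' => SLam_hessFF_inr_inr _ Lc κ u x y ν ν')]
  funext κ u
  congr 1
  rw [← mul_assoc]
  exact lam_unit_factor cΛ j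

/-- [folklore] **`hS`-SHAPE FOR THE LAGRANGE SUMMAND, UNIFORMLY IN `j`, FROM THE K-SLOT'S DECAY HALF**: if the unit-normalised step
resolvents decay uniformly (`UnitDecayK d Lc (sfStep Lc) (smStep d Lc) C δ`, `0 < δ` — the wall's `hK` in the adopted units), then for
every member `j + 1` the normalised (P-Λ) summand is a local stencil family with ONE `j`-free constant and rate `δ/4`. -/
theorem locStencil_unitS_lamPiece (hLc : 1 ≤ Lc) {C δ : ℝ} (hK : UnitDecayK d Lc (sfStep Lc) (smStep d Lc) C δ) (hδ : 0 < δ)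
    (cΛ : ℝ) (j : ℕ) :
    LocStencil (unitS (sfStep Lc (j + 1)) (smStep d Lc (j + 1))
        (fun κ u => (cΛ * wΛ d Lc (j + 1)) •
          SLam Lc (lamCoeffK (KInvStep (d := d) Lc (j + 1)) (E2 d Lc (j + 1)) Lc) (fun μ y => hessFF Lc μ y) κ u))
      (|cΛ * (Lc : ℝ) ^ (2 * (d + 1))| *
        ((d + 1 : ℕ) * (((Fintype.card (Fib d) : ℝ) * (C * C) * Zl (d + 1) (δ - δ / 2)) *
          (2 * (ell (d + 1) Lc : ℝ) ^ 2 * Real.exp (4 * ((d : ℝ) + 1) * Lc * (δ / 2))) * Zl (d + 1) (δ / 2 / 2))))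
      (δ / 2 / 2) := by
  rw [unitS_lamPiece_eq]
  have hA : Decays (KStepUnit (d := d) Lc (j + 1)) C δ := hK (j + 1)
  have hE : Decays ((smStep d Lc j) ^ 2 • E2 d Lc (j + 1)) C δ := decays_E2unit (hK j) hδ.le
  have hC : 0 ≤ C := hA.nonneg (Sum.inl 0)
  have hc := abs_lamCoeffK_le hA hE hδ Lc
  have hδ2 : (0 : ℝ) ≤ δ / 2 := by positivity
  have hQ : VertexFamily (fun μ y => hessFF (d := d) Lc μ y) Lc
      (2 * (ell (d + 1) Lc : ℝ) ^ 2 * Real.exp (4 * ((d : ℝ) + 1) * Lc * (δ / 2))) (δ / 2) :=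
    fun μ y => biLoc_hessFF hLc μ y hδ2
  have hS := locStencil_SLam (N := Lc) hc hQ (by positivity)
    (mul_nonneg (mul_nonneg (Nat.cast_nonneg _) (mul_nonneg hC hC)) (Zl_nonneg (by linarith)))
  exact StepJetData.locStencil_smul _ hS

end Main

end Summit.QuantumFields.BalabanUV.Beta.GAN24.StencilSlotLam

end
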